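import Mathlib
import Summits.Ventures.HodgeRepro.Tier4.Line4.LevelPhaseAbstract
import Summits.Ventures.HodgeRepro.Tier4.Line4.PlacePart
import Summits.Ventures.HodgeRepro.Tier4.Line4.LinRegularLocalElem

/-!
# Tier4/Line4/LevelPhaseAtP — PHASE-AT-P, the `p`-local half: the `p`-part phase `χ(b_S) · conj χ′(b′_S)` of the (7b) level
fibre pairs tends to `1` along `lev n = p^n`

Blind re-derivation cell `pub-hodge-repro`, Tier 4 «prove the step» (README §9–§10), seat t4-L4-p1 (prover, LINE L4,
gen 4; plan-4 g6's (2) S15640; statement S15681).  Tree path `lean/Summits/Ventures/HodgeRepro/Tier4/Line4/LevelPhaseAtP.lean`.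
Mathlib-level; no literature.

WHAT IS PROVED.  For `S` a set of finite places on which the level groups `K(p^N)` are trivial in the limit (`hS : ∀ v ∈ S,
natSize k v p < 1` — `S ⊆ placesAbove k p`), the `S`-part phase
`pPhase S q := R.chi ⟨(q.1)_S, _⟩ · conj (R.chi' ⟨(q.2)_S, _⟩)` (L2-p1's `GA.ofPlacesPart W S`, PlacePart):
* `pPhase_eq_one_of_stab` — it is `1` on the `K^{(p)}`-fibre: there `(b_v)⁻¹ (γ₀)_v b′_v = (γ₀)_v` at every `v ∈ S`
  (`K^{(p)}` is trivial at `S`, `mem_levelK_pow_forall_iff`), so by L1-p1's `mem_centre_of_stab_on` / `eq_of_stab_on`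
  (LinRegularLocalElem, from `IsLinRegular W γ₀`) `b_S ∈ Z` and `b′_S = b_S`, and `χ(z) conj χ′(z) = |χ(z)|² = 1`
  (`RTFData.chi_centre`, `hu`);
* `continuous_pPhase` — continuity (`continuous_ofPlacesPart`, `hc`, `hc'`);
* **`exists_level_pPhase_close`** — for a compact `C` containing the level fibres with `b ∈ DZ_f` from the level `n₁` on and
  every `ε > 0`: `‖pPhase S q − 1‖ < ε` on the level fibres from some level on (LevelPhaseAbstract's topological half).
So along `p`-powers the phase aligns AT `p` (and at nothing else — F-L4-PHASE-PPOWER); the away-from-`p` factor of (S-FIN-NV)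
is the level-one orbital integral, a display on `γ₀`.

Nothing here says anything about the status of the Hodge conjecture for CM abelian varieties, which is NOT proved
(HC_CM is NOT proved by anyone in this repository).
-/

set_option autoImplicit false

noncomputable section

namespace Summit.Ventures.HodgeRepro.Tier4.Line4

open Summit.Ventures.HodgeRepro.Tier4.Common Summit.Ventures.HodgeRepro.Tier4.Line1 NumberField IsDedekindDomain Topology
open scoped ComplexConjugate Pointwise

section PhaseAtP

variable {k : Type} [Field k] [NumberField k] (W : PlaneData k) [MeasurableSpace (GA W)] (R : RTFData W)
  (S : Set (HeightOneSpectrum (𝓞 k)))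

/-- **The `S`-part phase of a fibre pair**: `χ((b)_S) · conj χ′((b′)_S)`. -/
def pPhase (q : torusFin W × torusFin' W) : ℂ :=
  R.chi ⟨GA.ofPlacesPart W S ((q.1 : torusT W) : GA W), ofPlacesPart_mem_torusT W S (q.1 : torusT W).2⟩ *
    conj (R.chi' ⟨GA.ofPlacesPart W S ((q.2 : torusT' W) : GA W), ofPlacesPart_mem_torusT' W S (q.2 : torusT' W).2⟩)

/-- The `S`-part phase is continuous. -/
theorem continuous_pPhase (hc : Continuous R.chi) (hc' : Continuous R.chi') : Continuous (pPhase W R S) := by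
  unfold pPhase
  refine Continuous.mul ?_ (Complex.continuous_conj.comp ?_)
  · exact hc.comp (((continuous_ofPlacesPart W S).comp
      (continuous_subtype_val.comp (continuous_subtype_val.comp continuous_fst))).subtype_mk _)
  · exact hc'.comp (((continuous_ofPlacesPart W S).comp
      (continuous_subtype_val.comp (continuous_subtype_val.comp continuous_snd))).subtype_mk _)

omit [MeasurableSpace (GA W)] in
/-- the finite components of the finite part are those of the element -/
theorem finiteComponent_ofFinPart_eq (v : HeightOneSpectrum (𝓞 k)) (g : GA W) :
    GA.finiteComponent W v (GA.ofFinPart W g) = GA.finiteComponent W v g := by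
  apply Units.ext
  apply Matrix.ext
  intro i j
  rw [GA.finiteComponent_apply, GA.finiteComponent_apply, GA.mat_ofFinPart]
  rfl

/-- **The phase is `1` on the stabiliser pairs at `S`**: if `(b_v)⁻¹ (γ₀)_v b′_v = (γ₀)_v` for every `v ∈ S`, then
`b_S ∈ Z`, `b′_S = b_S` (LinRegularLocalElem) and `χ(b_S) conj χ′(b′_S) = |χ(b_S)|² = 1`. -/
theorem pPhase_eq_one_of_stab {γ₀ : rationalPoints W} (hlin : IsLinRegular W γ₀) (hu : ∀ a, ‖R.chi a‖ = 1)
    (q : torusFin W × torusFin' W)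
    (h : ∀ v, v ∈ S → (GA.finiteComponent W v ((q.1 : torusT W) : GA W))⁻¹ *
      GA.finiteComponent W v (γ₀ : GA W) * GA.finiteComponent W v ((q.2 : torusT' W) : GA W) =
        GA.finiteComponent W v (γ₀ : GA W)) :
    pPhase W R S q = 1 := by
  set t : GA W := ((q.1 : torusT W) : GA W) with htdef
  set t' : GA W := ((q.2 : torusT' W) : GA W) with ht'def
  have hinf : ∀ w : InfinitePlace k, GA.infiniteComponent W w (GA.ofPlacesPart W S t) = 1 :=
    (mem_finitePart W _).1 (ofPlacesPart_mem_finitePart W S t)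
  have hinf' : ∀ w : InfinitePlace k, GA.infiniteComponent W w (GA.ofPlacesPart W S t') = 1 :=
    (mem_finitePart W _).1 (ofPlacesPart_mem_finitePart W S t')
  have hcentre : GA.ofPlacesPart W S t ∈ centre W :=
    mem_centre_of_stab_on W S hlin (q.1 : torusT W).2 (q.2 : torusT' W).2 h
      (fun w hw => finiteComponent_ofPlacesPart_of_notMem W S hw t) hinf
      (fun w hw => finiteComponent_ofPlacesPart_of_mem W S hw t)
  have heq : GA.ofPlacesPart W S t' = GA.ofPlacesPart W S t :=
    eq_of_stab_on W S hlin (q.1 : torusT W).2 (q.2 : torusT' W).2 h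
      (fun w hw => finiteComponent_ofPlacesPart_of_notMem W S hw t)
      (fun w hw => finiteComponent_ofPlacesPart_of_notMem W S hw t') hinf hinf'
      (fun w hw => finiteComponent_ofPlacesPart_of_mem W S hw t)
      (fun w hw => finiteComponent_ofPlacesPart_of_mem W S hw t')
  unfold pPhase
  have hchi : R.chi' ⟨GA.ofPlacesPart W S t', ofPlacesPart_mem_torusT' W S (q.2 : torusT' W).2⟩ =
      R.chi ⟨GA.ofPlacesPart W S t, ofPlacesPart_mem_torusT W S (q.1 : torusT W).2⟩ := by
    have h1 : (⟨GA.ofPlacesPart W S t', ofPlacesPart_mem_torusT' W S (q.2 : torusT' W).2⟩ : torusT' W) =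
        ⟨GA.ofPlacesPart W S t, centre_le_torusT' W hcentre⟩ := Subtype.ext heq
    rw [h1, ← R.chi_centre (GA.ofPlacesPart W S t) hcentre]
  rw [hchi, Complex.mul_conj, Complex.normSq_eq_norm_sq, hu, one_pow, Complex.ofReal_one]

/-- **PHASE-AT-P**: for `S` a set of places at which the level groups shrink (`|p|_v < 1` on `S`) and a compact `C`
containing the level fibres (`b ∈ DZ_f`) from level `n₁` on, the `S`-part phase is uniformly `ε`-close to `1` on the level
fibres of `γ₀` from some level on. -/
theorem exists_level_pPhase_close {p : ℕ} (hp : p ≠ 0) (hS : ∀ v, v ∈ S → natSize k v p < 1)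
    {γ₀ : rationalPoints W} (hlin : IsLinRegular W γ₀)
    (hc : Continuous R.chi) (hu : ∀ a, ‖R.chi a‖ = 1) (hc' : Continuous R.chi')
    (DZf : Set (torusFin W)) (C : Set (torusFin W × torusFin' W)) (hC : IsCompact C) (n₁ : ℕ)
    (hsub : ∀ N ≥ n₁, ∀ q ∈ suppSet W (γ₀ : GA W) (p ^ N) (γ₀ : GA W), q.1 ∈ DZf → q ∈ C)
    {ε : ℝ} (hε : 0 < ε) :
    ∃ N₀ : ℕ, ∀ N ≥ N₀, ∀ q ∈ suppSet W (γ₀ : GA W) (p ^ N) (γ₀ : GA W), q.1 ∈ DZf →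
      ‖pPhase W R S q - 1‖ < ε := by
  refine exists_level_phase_close_of_eq_one_on_limit W hp (γ₀ : GA W) (γ₀ : GA W) DZf C hC n₁ hsub
    (pPhase W R S) (continuous_pPhase W R S hc hc').continuousOn (fun q _ hq => ?_) hε
  obtain ⟨a, ha, c, hc₀, hq⟩ := hq
  refine pPhase_eq_one_of_stab W R S hlin hu q fun v hv => ?_
  -- at `v ∈ S` the factors `a`, `c` are trivial (`K^{(p)}` is trivial at `S`)
  have ha1 : GA.finiteComponent W v a = 1 :=
    (((mem_levelK_pow_forall_iff W hp a).1 ((mem_levelKInf_iff W p a).1 ha)).2.1 v (hS v hv))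
  have hc1 : GA.finiteComponent W v c = 1 :=
    (((mem_levelK_pow_forall_iff W hp c).1 ((mem_levelKInf_iff W p c).1 hc₀)).2.1 v (hS v hv))
  have hq' := congrArg (GA.finiteComponent W v) hq
  unfold orbPair at hq'
  rw [map_mul, map_mul, map_inv, map_mul, map_mul, ha1, hc1, one_mul, mul_one, finiteComponent_ofFinPart_eq] at hq'
  exact hq'

end PhaseAtP

end Summit.Ventures.HodgeRepro.Tier4.Line4

end
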